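import Summits.BirchSwinnertonDyer.BirchSwinnertonDyer.Theses.ThetaPartnerAtTwo
import Summits.BirchSwinnertonDyer.BirchSwinnertonDyer.Theorems.ThetaPartnerAtTwoSignedMainConjectureCMTwoRankZeroLowerOffTwoAtTwo
import Summits.BirchSwinnertonDyer.BirchSwinnertonDyer.Theorems.ThetaPartnerAtTwoSignedMainConjectureCMTwoRankZeroLowerOffTwoOfCore
import Summits.BirchSwinnertonDyer.BirchSwinnertonDyer.Theorems.ThetaPartnerAtTwoSignedMainConjectureCMTwoRankZeroKatoDescentKSide
import Summits.BirchSwinnertonDyer.BirchSwinnertonDyer.Theorems.ThetaPartnerAtTwoSignedMainConjectureCMTwoRankZeroKatoDescentQSide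
import HarnessLib

/-! # Skeleton line `rankzero` v17 (K2R0P♭; ONE PUB/research stub on the tree's OWN objects = (CORE♭-lower)) — crux K2R0P♭
`SignedMainConjectureCMTwoRankZeroOfPubOfFlat` (item stmt-BirchSwinnertonDyer-26471; route ThetaPartnerAtTwo rev 38; lead prover bsd-wall-tp2-p2 g9,
2026-08-28; v17 supersedes v16 fa53419110521fcc of g8: v16's stub (LDℓ)_A is now the THEOREM `SignedLowerOffTwo.offTwoLower_of_coreLower`
(width seat tp2-p2-w2 g3, p620229) applied to the ONE statement (CORE♭-lower) below — the twin of the K3 lineage's v10 `stub_katoZetaErlTwo`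
(crux `SignedKatoDivisibilityUpToAtTwo`, line `colemanrat`), for THE `T₂A`-adic local Tate pairing of the tree)

K2R0P♭ = PUB¹⁰ → FLAT (`AnalyticMuFlatCMTwoRankZero`, item 26470, by name) → the K2r0 body. ONE stub:
* `stub_coreLowerCMTwo` ((CORE♭-lower), PUB/research-shaped, every object a tree object): for every place `v ∋ 2`, CM class member `A` off the
  unit zone, normalised cyclotomic datum, newform, period ratio `ϖ`, Pollack pair at 2, fine dual datum `Y`, height-one `𝔭′ ∌ 2`, EVERY pinned
  `I = 𝐇¹_Γ(T₂A)` and EVERY `ℤ₂`-linear layer pairing family `pair` with (P1)(P2)(P3)[THE Weil pairings] (= «`pair` IS the `T₂A`-adic local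
  Tate pairing»): ∃ local generator `g`, plus Honda system `d` ((L)(TR)(GEN)(GEN₀) — tree: HONDA⁺@2), a class `s ∈ 𝐇¹`, an exponent `m` with
  (PT♭)_layer [Kobayashi 2003 Thm 7.3 (ii): exactness of the Λ-adic Poitou–Tate sequence at the local term, read on THE pairing — print (Milne ADT
  I.4.10); tree named fact `GaloisCohomology.poitouTate_selmerStructure_duality` (SelmerComplement) + Shapiro + limits],
  (ERL♭ ⊇) [`L♭ ∣ Col♭(col₀ s)` at `𝔭′` for every glue `col₀` of `pair` along `I`: the ⊇ half of the explicit reciprocity law at 2 = Kato 2004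
  Thm 12.5 / (15.12.2)+Prop 15.9+(15.16.1) for the CM form `f_A` read through the signed theory at 2 (Kobayashi 6.3 / Sprung §7, Otsuki 2009) — PUB;
  K3's CORE consumes the ⊆ half of the SAME print equality], and
  (g)^ι [`ℓ_{𝔭′}(𝐇¹/Λs) ≤ ℓ_{ι𝔭′}(X₀)`: the EQUALITY half of Kato's IMC 12.10 for `f_A` off `(2)` — Johnson-Leung–Kings 2011 Thm 5.7 / §7.2 on the
  `K(p^∞𝔣)`-tower descended by Kato Lemma 15.13; KERNEL chain of this lineage: `KatoDescent.length_quotient_span_ell_le_length_quotSMulTop(_of_length_ne_top)`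
  (g9, p619744/p620022: JLK §7.2 BY NAME on `D : Kato2004.EllipticUnitTower` via er2-ty1's `thm57RegularShape_lengthAt_atPrime_eq_of_not_mem`, composed
  with Kato Lemma 14.15 `KatoDescent.length_quotSMulTop_eq_length_tors_add_Phi` p618102 and the descent inequality p618804) ∘ the typed facts
  {Kato L.15.13 (1), (15.13.1), (15.13.2), (15.16.1)+§15.15 (`s = z_A ≠ 0`; `hz` discharged ℚ-side by `KatoDescent.iwasawaH1_mem_span_singleton_of_smul_mkLinearMap_eq_zero`,
  p620290)} («CyclotomicTransport» typer unit, er2-ty1 design #26 §B) ∘ the ℚ-side Poitou–Tate reading `ℓ_{𝔭′}(𝐇²_Γ(T₂A)) ≤ ℓ_{ι𝔭′}(X₀)`].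
  Hardest stub: this one (only one); its three clauses are PUB / typed-fact shaped, none is kernel work on untyped mathematics. Leans on: the CM
  twin of K3's PUB typing (ERL♭ at 2 on `CyclotomicLayer.tatePairingPk`, K3-w3 p619606), the Λ-adic Poitou–Tate named fact, and «CyclotomicTransport».
Composition (kernel, no sorry of its own): `intro` PUB¹⁰, FLAT, A; `SignedLowerOffTwo.signedMainConjectureCMTwoRankZero_body_of_pub_of_offTwoLower_of_flat`
(w2 g2 p610476) fed with `SignedLowerOffTwo.offTwoLower_of_coreLower stub_coreLowerCMTwo` (w2 g3 p620229). v16's (LDℓ)_A is implied (it IS the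
conclusion of `offTwoLower_of_coreLower`); nothing of v16 is lost. BSD is not proved by any of this.
-/

set_option autoImplicit false
set_option linter.dupNamespace false

noncomputable section

open scoped Classical NumberField MatrixGroups ModularForm

open NumberField IsDedekindDomain CongruenceSubgroup WeierstrassCurve Literature Literature.NumberTheory.EllipticCurves
  Literature.NumberTheory.GaloisRepresentations Literature.NumberTheory.EllipticCurves.ModularForms
  Literature.NumberTheory.EllipticCurves.Rank1Residual Literature.NumberTheory.EllipticCurves.IwasawaDual
  Literature.NumberTheory.EllipticCurves.Kobayashi2003 Literature.NumberTheory.EllipticCurves.Module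
  Literature.NumberTheory.EllipticCurves.Kato2004 Literature.NumberTheory.EllipticCurves.Kato2004.EulerSystemValues
  Literature.NumberTheory.EllipticCurves.GreenbergSelmer Literature.NumberTheory.EllipticCurves.Sprung2012
  ZpExtension Summit.BirchSwinnertonDyer.Rank1Residual.Supersingular
  Summit.BirchSwinnertonDyer.BirchSwinnertonDyer.Theorems.SignedKatoOffTwo

namespace Summit.BirchSwinnertonDyer.BirchSwinnertonDyer.Cruxes.SignedMainConjectureCMTwoRankZeroOfPubOfFlat.RankZero

/-- ((CORE♭-lower) — the ONE stub; PUB/research-shaped; binders = the K3 lineage's v10 `stub_katoZetaErlTwo` VERBATIM with `¬ HasCM ↦ HasCM`,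
the zone antecedent, the fine dual datum `Y`; conjuncts = Honda (L)(TR)(GEN)(GEN₀) ∧ (PT♭)_layer ∧ (ERL♭ ⊇) ∧ (g)^ι; see the module docstring
for the print source of each clause and the kernel chain behind (g)^ι.)
[cite: Kobayashi2003, Thm. 6.2–6.3 (p. 11), (7.17)–(7.21), Thm. 7.3 (pp. 12–13), (8.23) (p. 18)] [cite: Kato2004Asterisque, Thm. 12.4–12.5 (pp. 221–222),
Conj. 12.10 (p. 224), Lemma 14.15 (pp. 243–244), Prop. 15.9 (p. 258), (15.12.2), Lemma 15.13, §15.15, (15.16.1), Prop. 15.17 (pp. 263–265), §17.13 (p. 280)]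
[cite: JohnsonLeungKings2011, Thm. 5.2, Thm. 5.7 and §7.2] [cite: Sprung2012, Def. 5.9, §7] [cite: PollackRubin2004, Thm. 7.3 (p > 2)] -/
theorem stub_coreLowerCMTwo :
    ∀ (v : HeightOneSpectrum (𝓞 ℚ)), ((2 : ℕ) : 𝓞 ℚ) ∈ v.asIdeal →
      ∀ (A : WeierstrassCurve ℚ) [A.IsElliptic] [A.IsGloballyMinimal],
        A.HasCM → A.analyticRank = 0 → GoodSS A 2 → A.frobeniusTrace 2 = 0 →
        2 ∣ A.shaOrder * A.tamagawaProduct →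
        ∀ (κ : ZpExtension ℚ 2) (γ : Field.absoluteGaloisGroup ℚ),
          κ.IsCyclotomic → κ.IsTopGenerator γ → IsCyclotomicVariable 2 γ →
        ∀ [NeZero (A.conductorNorm ℤ)] (f : CuspForm (Gamma0 (A.conductorNorm ℤ)) 2),
          IsNewformOf A f → ∀ (ϖ : ℚ), (ϖ : ℝ) * A.realPeriodRat = plusPeriod f →
        ∀ (Lplus Lminus : IwasawaAlgebra 2), IsPollackPair f 2 Lplus Lminus →
        ∀ [ContinuousSMul ℤ_[2] (A.tateModule 2)] (Y : A.FineSelmerDualData κ γ),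
        ∀ 𝔭' : PrimeSpectrum (IwasawaAlgebra 2), 𝔭'.asIdeal.height = 1 →
          PowerSeries.C (2 : ℤ_[2]) ∉ 𝔭'.asIdeal →
        ∀ (I : Kato2004.IwasawaH1Data A 2 κ γ)
          (pair : ∀ n : ℕ, H1 (tateRep A 2) (κ.layerSubgroup n) →ₗ[ℤ_[2]]
            (localLayerPointsOfEmb κ (closureEmb (K := ℚ) (v.adicCompletion ℚ)) A n →+ ℤ_[2])),
          -- (P1) projection formula
          (∀ (n : ℕ) (x : H1 (tateRep A 2) (κ.layerSubgroup (n + 1))) (Q : localPoints A (v.adicCompletion ℚ))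
            (hQ : Q ∈ localLayerPointsOfEmb κ (closureEmb (K := ℚ) (v.adicCompletion ℚ)) A n),
            pair n (layerCores (tateRep A 2) κ n x) ⟨Q, hQ⟩ =
              pair (n + 1) x ⟨Q, localLayerPointsOfEmb_mono κ (closureEmb (K := ℚ) (v.adicCompletion ℚ)) A (Nat.le_succ n) hQ⟩) →
          -- (P2) Galois invariance, for EVERY `g ∈ Γ_v`
          (∀ (n : ℕ) (g : Field.absoluteGaloisGroup (v.adicCompletion ℚ)) (y : H1 (tateRep A 2) (κ.layerSubgroup n))
            (Q : localPoints A (v.adicCompletion ℚ))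
            (hQ : Q ∈ localLayerPointsOfEmb κ (closureEmb (K := ℚ) (v.adicCompletion ℚ)) A n),
            pair n (conjMap (tateRep A 2).toTopRep (κ.layerSubgroup n) (resGalOfEmb (closureEmb (K := ℚ) (v.adicCompletion ℚ)) g) 1 y)
              ⟨g • Q, smul_mem_localLayerPointsOfEmb κ (closureEmb (K := ℚ) (v.adicCompletion ℚ)) A n g hQ⟩ = pair n y ⟨Q, hQ⟩) →
          -- (P3) residue clause: `pair` IS the `T₂A`-adic local Tate pairing (THE Weil pairings of the tree)
          (∀ (n k : ℕ) (x : H1 (tateRep A 2) (κ.layerSubgroup n))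
            (Q : localLayerPointsOfEmb κ (closureEmb (K := ℚ) (v.adicCompletion ℚ)) A n),
            PadicInt.toZModPow k (pair n x Q) =
              LayerPairing.layerPairingPk A κ v (LayerPairing.weilTowerPk A) (LayerPairing.weilTowerPk_pow A)
                (LayerPairing.weilTowerPk_add_left A) (LayerPairing.weilTowerPk_add_right A) (LayerPairing.weilTowerPk_smul A)
                n k x Q) →
        ∃ (g : Field.absoluteGaloisGroup (v.adicCompletion ℚ))
          (_ : κ.IsTopGenerator (resGalOfEmb (closureEmb (K := ℚ) (v.adicCompletion ℚ)) g))
          (d : ℕ → localPoints A (v.adicCompletion ℚ)) (s : I.H) (m : ℕ),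
          (∀ n, d n ∈ localLayerPointsOfEmb κ (closureEmb (K := ℚ) (v.adicCompletion ℚ)) A n) ∧
          (∀ n, localTraceOfEmb κ (closureEmb (K := ℚ) (v.adicCompletion ℚ)) A (n + 1) (n + 2) (d (n + 2)) = -d n) ∧
          (∀ n : ℕ, 1 ≤ n → ∀ P ∈ localLayerPointsOfEmb κ (closureEmb (K := ℚ) (v.adicCompletion ℚ)) A n,
            ∃ B ∈ AddSubgroup.closure (Set.range fun σ : Field.absoluteGaloisGroup (v.adicCompletion ℚ) ↦ σ • d n),
              ∃ P' ∈ localLayerPointsOfEmb κ (closureEmb (K := ℚ) (v.adicCompletion ℚ)) A (n - 1),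
              ∃ R ∈ localLayerPointsOfEmb κ (closureEmb (K := ℚ) (v.adicCompletion ℚ)) A n, P = B + P' + 2 • R) ∧
          (∀ P ∈ localLayerPointsOfEmb κ (closureEmb (K := ℚ) (v.adicCompletion ℚ)) A 0,
            ∃ a : ℤ, ∃ R ∈ localLayerPointsOfEmb κ (closureEmb (K := ℚ) (v.adicCompletion ℚ)) A 0, P = a • d 0 + 2 • R) ∧
          -- (PT♭)_layer: the deep Poitou–Tate half, read on THE pairing
          (∀ z : localTowerPointsOfEmb κ (closureEmb (K := ℚ) (v.adicCompletion ℚ)) A →+ ℤ_[2],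
            (∀ (t : A.subgroupH1 2 κ.kerSubgroup), t ∈ signedSelmerInfty A κ 1 →
              ∀ (φ : contOneCocycles (discreteTopRep κ.kerSubgroup (A.geomPrimaryTorsion 2)))
                (Q : localPoints A (v.adicCompletion ℚ)) (k : ℕ), oneCocycleClass _ φ = t →
              ∀ hQ : 2 ^ k • Q ∈ (⨆ n, signedLocalPoints κ (v.adicCompletion ℚ) A 1 n),
              (∀ τ : localSubgroupOfEmb κ.kerSubgroup (closureEmb (K := ℚ) (v.adicCompletion ℚ)),
                pointsMapOfEmb A (closureEmb (K := ℚ) (v.adicCompletion ℚ))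
                    ((φ.1 (resGalSubgroupOfEmb κ.kerSubgroup _ τ) : A.geomPrimaryTorsion 2) : A.geomPoints) =
                  (τ : Field.absoluteGaloisGroup (v.adicCompletion ℚ)) • Q - Q) →
              (PadicInt.toZModPow k
                  (z ⟨2 ^ k • Q, KummerPoint.iSup_signedLocalPoints_le_localTowerPointsOfEmb A 2 κ 1 v hQ⟩)).val •
                ((((2 : ℚ) ^ k)⁻¹ : ℚ) : AddCircle (1 : ℚ)) = 0) →
            ∃ x : I.H, ∀ (n : ℕ) (Q : localPoints A (v.adicCompletion ℚ))
              (hQ : Q ∈ signedLocalPointsOfEmb κ (closureEmb (K := ℚ) (v.adicCompletion ℚ)) A 1 n),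
              (2 : ℤ_[2]) ^ m *
                  z ⟨Q, localLayerPointsOfEmb_le_localTowerPointsOfEmb κ _ A n (signedLocalPointsOfEmb_le κ _ A 1 n hQ)⟩ =
                pair n (I.proj n x) ⟨Q, signedLocalPointsOfEmb_le κ _ A 1 n hQ⟩) ∧
          -- (ERL♭ ⊇) for every glue of `pair` along `I`
          (∀ col₀ : I.H →+ (localTowerPointsOfEmb κ (closureEmb (K := ℚ) (v.adicCompletion ℚ)) A →+ ℤ_[2]),
            (∀ (n : ℕ) (x : I.H) (Q : localPoints A (v.adicCompletion ℚ))
              (hQ : Q ∈ localLayerPointsOfEmb κ (closureEmb (K := ℚ) (v.adicCompletion ℚ)) A n),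
              col₀ x ⟨Q, localLayerPointsOfEmb_le_localTowerPointsOfEmb κ (closureEmb (K := ℚ) (v.adicCompletion ℚ)) A n hQ⟩ =
                pair n (I.proj n x) ⟨Q, hQ⟩) →
            ∀ Ls Lf : IwasawaAlgebra 2, IsColemanPair κ (closureEmb (K := ℚ) (v.adicCompletion ℚ)) A 0 g d (col₀ s) Ls Lf →
              lengthAt (IwasawaAlgebra 2) (IwasawaAlgebra 2 ⧸ Ideal.span {kobayashiL 1 Lplus Lminus}) 𝔭' ≤
                lengthAt (IwasawaAlgebra 2) (IwasawaAlgebra 2 ⧸ Ideal.span {Lf}) 𝔭') ∧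
          -- (g)^ι the CM `𝐇¹`-side comparison, print-exact mixed-prime form
          lengthAt (IwasawaAlgebra 2) (I.H ⧸ Submodule.span (IwasawaAlgebra 2) {s}) 𝔭' ≤
            lengthAt (IwasawaAlgebra 2) Y.X (PrimeSpectrum.comap (IwasawaAlgebra.invol 2).toRingHom 𝔭') := by
  sorry

/-- COMPOSITION (kernel-checked, no sorry of its own): PUB¹⁰, FLAT, `A` ↦ w2 g2's turnkey fed with w2 g3's `offTwoLower_of_coreLower` applied to the stub. -/
theorem SignedMainConjectureCMTwoRankZeroOfPubOfFlat_of :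
    Summit.BirchSwinnertonDyer.BirchSwinnertonDyer.Theses.ThetaPartnerAtTwo.SignedMainConjectureCMTwoRankZeroOfPubOfFlat :=
  fun hBF hmod hLrat hGZK h2 hC h412 hcork hP108 hWL hμ A _ _ hcm hr hss ha ↦
    Summit.BirchSwinnertonDyer.BirchSwinnertonDyer.Theorems.SignedLowerOffTwo.signedMainConjectureCMTwoRankZero_body_of_pub_of_offTwoLower_of_flat
      hBF hmod hLrat hGZK h2 hC h412 hcork hP108 hWL
      (Summit.BirchSwinnertonDyer.BirchSwinnertonDyer.Theorems.SignedLowerOffTwo.offTwoLower_of_coreLower stub_coreLowerCMTwo)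
      hμ A hcm hr hss ha

end Summit.BirchSwinnertonDyer.BirchSwinnertonDyer.Cruxes.SignedMainConjectureCMTwoRankZeroOfPubOfFlat.RankZero

end
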